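import Mathlib
import Literature.Barriers.NavierStokesRegularity.DyadicInvariantRegion
import Literature.Analysis.ODE.MaximalTime
import HarnessLib

/-!
# The VIRTUAL-FLOOR GAME reduction for the rescaled Katz–Pavlović chain (abstract first-crossing lemma)
(helper file for crux stmt-NavierStokesRegularity-27057 `SubOnsagerCeiling.ForwardTailCeilingKP`, `--supports … --as helper`;
LEAD SOC census v9 §G.5 / idea card `Cruxes/ForwardTailCeilingKP/Ideas/virtual-floor-game.md`)

Every scale-ratio rung in the tree bounds the rescaled chain `Ẏₙ = -κₙYₙ + Fₙ(Y²ₙ₋₁ - pYₙYₙ₊₁)`, `Fₙ₊₁ = LFₙ`, by a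
STATIC window region (Barbato–Morandin–Romito type); LEAD g6's census v9 measured that no such region exists below
`p ≈ 1.50` (`b ≈ 1.51`). This file proves the reduction behind the proposed replacement, a TIME-AWARE finite-
dimensional criterion:

**The game.** Fix a depth `k`, the constants `p, L`, a datum size `δ₀`. A PLAY on `[0, T]` with rate `Fr > 0` is a
family of `k+1` «real shells» `S₀, …, S_k ≥ 0` with `Sᵢ(0) ≤ δ₀`, exact dynamics
`Ṡᵢ = -dᵢSᵢ + Fr·Lⁱ(feedᵢ² - p·Sᵢ·drainᵢ)` (`feed₀ = v`, `feedᵢ = Sᵢ₋₁`; `drain_k = y`, `drainᵢ = Sᵢ₊₁`), arbitrary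
dampings `dᵢ ≥ 0`, an arbitrary FEED `v(t) ∈ [0, 1]` below the window, and a DRAIN `y(t) ∈ [0, 1]` above it which is a
VIRTUAL FLOOR: `ẏ ≥ -d_y·y + Fr·L^{k+1}(S_k² - p·y)` (the successor shell can be held small only as long as the
dynamics allows). The GAME HYPOTHESIS `hGame` says: in every play, every real shell stays `< 1` on `[0, T]`.

**The reduction (`gameBarrier_le_one_of_tail`).** If the game hypothesis holds for `(k, p, L, δ₀)`, then along the
rescaled chain on `[0, s]` from data `Yₙ(0) ≤ δ₀ < 1` (`Y₀ ≡ 0`, shells non-negative, tail quiescent `Yₙ ≤ δ₀` for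
`n ≥ K`) EVERY shell stays `≤ 1`. Proof: first-crossing (`maximalTimeP`); at the crossing shell `N` the window
`Y_{m}, …, Y_{m+k}`, `m = max(1, N - k)`, IS a play on `[0, T*]` — feed `Y_{m-1} ∈ [0,1]`, dampings `κ`, and the shell
above the window is a virtual floor because `Y_{m+k+2} ≤ 1` before the crossing — so `Y_N(T*) < 1`.

Why this is the right object (census v9 §G.5, numerics): the ℓ^∞ gain of the FORCED chain from rest is `0.96` at
`b = 5/4` and the measured game values are `V₃ ≈ 0.99`, `V₄ ≈ 0.94` there (`V₂ < 1` for `b ≳ 1.35`), viscosity only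
lowering them; a certificate for `hGame` is a robust-invariance polynomial barrier in dimension `k + 2`. No certificate
is proved here: this file is the pure-ODE half of the proposed line.

HONEST FRAMING: an abstract ODE lemma towards a MODEL-lattice rung (crux `ForwardTailCeilingKP`, route SubOnsagerCeiling,
TL-M2Break); by itself it proves no class of tables; nothing here bears on Navier–Stokes regularity; 27057 stays OPEN.
[cite: BarbatoMorandinRomito2011, §2 Lemma 2.1 (the first-exit scheme this replaces)]
-/

noncomputable section

-- the sub-problem namespace `NavierStokesRegularity.NavierStokesRegularity` is the tree's layout (D-0017)
set_option linter.dupNamespace false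

namespace Summit.NavierStokesRegularity.NavierStokesRegularity.Theorems.VirtualFloor

open Set Filter Topology
open Literature.Barriers.NavierStokesRegularity.Dyadic

/-- Rates along the chain: `F (m + i) = F m * L ^ i`. [folklore] -/
theorem rate_shift {F : ℕ → ℝ} {L : ℝ} (hFL : ∀ n, F (n + 1) = L * F n) (m i : ℕ) :
    F (m + i) = F m * L ^ i := by
  induction i with
  | zero => simp
  | succ i ih => rw [Nat.add_succ, hFL, ih]; ring

/-- A continuous function that is `< 1` on `[0, T)` is `≤ 1` on `[0, T]` (`0 < T ≤ s`). [folklore] -/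
theorem le_one_of_lt_one_Ico {f : ℝ → ℝ} {s T : ℝ} (hf : ContinuousOn f (Icc 0 s)) (hT : T ∈ Ioc 0 s)
    (h : ∀ t ∈ Ico 0 T, f t < 1) : ∀ t ∈ Icc 0 T, f t ≤ 1 := by
  intro t ht
  rcases lt_or_eq_of_le ht.2 with hlt | rfl
  · exact (h t ⟨ht.1, hlt⟩).le
  · exact le_of_forall_Ico_le hf continuousOn_const hT fun u hu => (h u hu).le

/-- **THE VIRTUAL-FLOOR GAME REDUCTION** (see the module docstring): if every play of the depth-`k` game with
constants `p, L`, datum size `δ₀` keeps its real shells `< 1`, then every shell of the rescaled chain from data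
`≤ δ₀` (non-negative shells, quiescent tail) stays `≤ 1`. MODEL-lattice ODE lemma. [this file] -/
theorem gameBarrier_le_one_of_tail {Y : ℕ → ℝ → ℝ} {κ F : ℕ → ℝ} {L p s δ₀ : ℝ} {K k : ℕ}
    (hs : 0 < s) (hκ : ∀ n, 0 ≤ κ n) (hF : ∀ n, 0 < F n) (hFL : ∀ n, F (n + 1) = L * F n)
    (hp : 0 < p) (hδ₀ : δ₀ < 1)
    (hGame : ∀ (Fr T : ℝ), 0 < Fr → 0 < T →
      ∀ (S : ℕ → ℝ → ℝ) (d : ℕ → ℝ) (v y : ℝ → ℝ) (dy : ℝ),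
      (∀ i, i ≤ k → ContinuousOn (S i) (Icc 0 T)) → ContinuousOn y (Icc 0 T) →
      (∀ i, i ≤ k → ∀ t ∈ Ico 0 T, HasDerivWithinAt (S i)
        (-d i * S i t + Fr * L ^ i * ((if i = 0 then v t else S (i - 1) t) ^ 2 -
          p * S i t * (if i = k then y t else S (i + 1) t))) (Ici t) t) →
      (∀ t ∈ Ico 0 T, ∃ y' : ℝ, HasDerivWithinAt y y' (Ici t) t ∧
        -dy * y t + Fr * L ^ (k + 1) * (S k t ^ 2 - p * y t) ≤ y') →
      (∀ i, i ≤ k → 0 ≤ d i) → 0 ≤ dy →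
      (∀ t ∈ Icc 0 T, 0 ≤ v t ∧ v t ≤ 1) → (∀ t ∈ Icc 0 T, 0 ≤ y t ∧ y t ≤ 1) →
      (∀ i, i ≤ k → ∀ t ∈ Icc 0 T, 0 ≤ S i t) → (∀ i, i ≤ k → S i 0 ≤ δ₀) →
      ∀ i, i ≤ k → ∀ t ∈ Icc 0 T, S i t < 1)
    (hY0 : ∀ t, Y 0 t = 0)
    (hcont : ∀ n, ContinuousOn (Y n) (Icc 0 s))
    (hderiv : ∀ n, 1 ≤ n → ∀ t ∈ Ico 0 s, HasDerivWithinAt (Y n)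
      (-κ n * Y n t + F n * (Y (n - 1) t ^ 2 - p * Y n t * Y (n + 1) t)) (Ici t) t)
    (hpos : ∀ n, ∀ t ∈ Icc 0 s, 0 ≤ Y n t)
    (hinit : ∀ n, Y n 0 ≤ δ₀)
    (htail : ∀ n, K ≤ n → ∀ t ∈ Icc 0 s, Y n t ≤ δ₀) :
    ∀ n, ∀ t ∈ Icc 0 s, Y n t ≤ 1 := by
  -- the bootstrap predicate: the first `K` shells are `< 1`
  set P : ℝ → Prop := fun t => ∀ n, n ≤ K → Y n t < 1 with hP
  have hall : ∀ t ∈ Icc (0 : ℝ) s, P t → ∀ n, Y n t < 1 := by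
    intro t ht hPt n
    rcases le_or_gt n K with hn | hn
    · exact hPt n hn
    · exact (htail n hn.le t ht).trans_lt hδ₀
  have hP0 : P 0 := fun n _ => (hinit n).trans_lt hδ₀
  -- THE HEART: `P` is closed from the left — the game at the would-be crossing shell
  have key : ∀ T ∈ Ioc (0 : ℝ) s, (∀ t ∈ Ico 0 T, P t) → P T := by
    intro T hT hPT n hnK
    have hTs : Icc (0 : ℝ) T ⊆ Icc 0 s := Icc_subset_Icc_right hT.2
    have hTs' : Ico (0 : ℝ) T ⊆ Ico 0 s := Ico_subset_Ico_right hT.2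
    -- every shell is `< 1` on `[0, T)` and `≤ 1` on `[0, T]`
    have hlt : ∀ j, ∀ t ∈ Ico (0 : ℝ) T, Y j t < 1 := fun j t ht => hall t (hTs (Ico_subset_Icc_self ht)) (hPT t ht) j
    have hle : ∀ j, ∀ t ∈ Icc (0 : ℝ) T, Y j t ≤ 1 := fun j => le_one_of_lt_one_Ico (hcont j) hT (hlt j)
    rcases Nat.eq_zero_or_pos n with rfl | hn1
    · rw [hY0]; exact one_pos
    -- the window `m, …, m + k` with `m = max 1 (n - k)` contains `n = m + j`
    set m : ℕ := max 1 (n - k) with hm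
    have hm1 : 1 ≤ m := le_max_left _ _
    obtain ⟨j, hjk, hnj⟩ : ∃ j, j ≤ k ∧ n = m + j := by
      refine ⟨n - m, ?_, ?_⟩ <;> simp only [hm] <;> omega
    -- the play
    have hFm : 0 < F m := hF m
    have hrate : ∀ i, F (m + i) = F m * L ^ i := rate_shift hFL m
    have hplay := hGame (F m) T hFm hT.1 (fun i => Y (m + i)) (fun i => κ (m + i)) (Y (m - 1)) (Y (m + k + 1))
      (κ (m + k + 1))
      (fun i _ => (hcont (m + i)).mono hTs) ((hcont (m + k + 1)).mono hTs)
      ?_ ?_ (fun i _ => hκ (m + i)) (hκ (m + k + 1))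
      (fun t ht => ⟨hpos (m - 1) t (hTs ht), hle (m - 1) t ht⟩)
      (fun t ht => ⟨hpos (m + k + 1) t (hTs ht), hle (m + k + 1) t ht⟩)
      (fun i _ t ht => hpos (m + i) t (hTs ht)) (fun i _ => hinit (m + i))
      j hjk T ⟨hT.1.le, le_rfl⟩
    · rw [hnj]; exact hplay
    · -- the real shells obey the game dynamics (rates `F m · Lⁱ`, feeds and drains re-indexed)
      intro i hi t ht
      have h := hderiv (m + i) (by omega) t (hTs' ht)
      rw [hrate i] at h
      refine h.congr_deriv ?_
      have e1 : (if i = 0 then Y (m - 1) t else Y (m + (i - 1)) t) = Y (m + i - 1) t := by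
        split_ifs with hi0
        · rw [hi0, Nat.add_zero]
        · congr 1; omega
      have e2 : (if i = k then Y (m + k + 1) t else Y (m + (i + 1)) t) = Y (m + i + 1) t := by
        split_ifs with hik
        · rw [hik]
        · rfl
      rw [e1, e2]
    · -- the shell above the window is a VIRTUAL FLOOR while the shell above it is `≤ 1`
      intro t ht
      refine ⟨-κ (m + k + 1) * Y (m + k + 1) t + F (m + k + 1) *
          (Y (m + k + 1 - 1) t ^ 2 - p * Y (m + k + 1) t * Y (m + k + 1 + 1) t),
        hderiv (m + k + 1) (by omega) t (hTs' ht), ?_⟩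
      have hr : F (m + k + 1) = F m * L ^ (k + 1) := by rw [← hrate (k + 1)]; rfl
      have e1 : m + k + 1 - 1 = m + k := by omega
      rw [hr, e1]
      have hy0 : 0 ≤ Y (m + k + 1) t := hpos _ t (hTs (Ico_subset_Icc_self ht))
      have hz1 : Y (m + k + 1 + 1) t ≤ 1 := hle _ t (Ico_subset_Icc_self ht)
      have hFL0 : 0 ≤ F m * L ^ (k + 1) := by rw [← hr]; exact (hF _).le
      have h1 : p * Y (m + k + 1) t * Y (m + k + 1 + 1) t ≤ p * Y (m + k + 1) t :=
        mul_le_of_le_one_right (mul_nonneg hp.le hy0) hz1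
      nlinarith [mul_le_mul_of_nonneg_left h1 hFL0]
  -- the maximal time of `P` is `s`, and `P` holds on `[0, s]`
  have hPall : ∀ t ∈ Icc (0 : ℝ) s, P t := by
    set T := Literature.Analysis.ODE.maximalTimeP P 0 s with hT
    have hTmem : T ∈ Icc (0 : ℝ) s := Literature.Analysis.ODE.maximalTimeP_mem hs.le hP0
    have hPT : ∀ t ∈ Icc (0 : ℝ) T, P t := fun t ht =>
      Literature.Analysis.ODE.maximalTimeP_spec hs.le hP0 key ht
    -- `P` is an open condition on finitely many continuous shells: it holds right after `T`
    have hev : ∀ᶠ t in 𝓝[Icc 0 s] T, P t := by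
      have hfin : ∀ n ∈ Finset.range (K + 1), ∀ᶠ t in 𝓝[Icc 0 s] T, Y n t < 1 := by
        intro n _
        have hc : ContinuousWithinAt (Y n) (Icc 0 s) T := hcont n T hTmem
        exact hc.eventually_lt continuousWithinAt_const (hPT T ⟨hTmem.1, le_rfl⟩ n (by
          have := Finset.mem_range.1 ‹n ∈ Finset.range (K + 1)›; omega))
      have := (Finset.eventually_all (Finset.range (K + 1))).2 hfin
      filter_upwards [this] with t ht n hn
      exact ht n (Finset.mem_range.2 (Nat.lt_succ_of_le hn))
    by_cases hTs : T = s
    · intro t ht; exact hPT t (hTs ▸ ht)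
    · exact absurd hev (Literature.Analysis.ODE.not_eventually_of_maximalTimeP_lt hs.le hP0
        (lt_of_le_of_ne hTmem.2 hTs))
  intro n t ht
  exact (hall t ht (hPall t ht) n).le

/-- **THE VIRTUAL-FLOOR GAME REDUCTION, GEOMETRIC DAMPING** — the CERTIFIABLE form (LEAD g6 correction of the
statement above: with INDEPENDENT dampings `dᵢ ≥ 0` the game hypothesis is false — kill the middle shell by a huge
`d₁` and the bottom shell, fed and undrained, leaves the box; on Tao's lattice the dampings are RIGID,
`κₙ₊₁ = b²·κₙ`, so a play carries ONE scalar `d ≥ 0` with the profile `d·b2ⁱ` on shell `i` and `d·b2^{k+1}` on the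
floor). If every play of the depth-`k` game with constants `p, L, b2`, datum size `δ₀` and dampings `d·b2ⁱ` keeps its
real shells `< 1`, then every shell of the rescaled chain (dampings `κₙ₊₁ = b2·κₙ ≥ 0`) from data `≤ δ₀` stays `≤ 1`.
MODEL-lattice ODE lemma. [this file] -/
theorem gameBarrier_le_one_of_tail_geom {Y : ℕ → ℝ → ℝ} {κ F : ℕ → ℝ} {L p s δ₀ b2 : ℝ} {K k : ℕ}
    (hs : 0 < s) (hκ : ∀ n, 0 ≤ κ n) (hκg : ∀ n, κ (n + 1) = b2 * κ n) (hF : ∀ n, 0 < F n)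
    (hFL : ∀ n, F (n + 1) = L * F n)
    (hp : 0 < p) (hδ₀ : δ₀ < 1)
    (hGame : ∀ (Fr T : ℝ), 0 < Fr → 0 < T →
      ∀ (S : ℕ → ℝ → ℝ) (d : ℝ) (v y : ℝ → ℝ),
      (∀ i, i ≤ k → ContinuousOn (S i) (Icc 0 T)) → ContinuousOn y (Icc 0 T) →
      (∀ i, i ≤ k → ∀ t ∈ Ico 0 T, HasDerivWithinAt (S i)
        (-(d * b2 ^ i) * S i t + Fr * L ^ i * ((if i = 0 then v t else S (i - 1) t) ^ 2 -
          p * S i t * (if i = k then y t else S (i + 1) t))) (Ici t) t) →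
      (∀ t ∈ Ico 0 T, ∃ y' : ℝ, HasDerivWithinAt y y' (Ici t) t ∧
        -(d * b2 ^ (k + 1)) * y t + Fr * L ^ (k + 1) * (S k t ^ 2 - p * y t) ≤ y') →
      0 ≤ d →
      (∀ t ∈ Icc 0 T, 0 ≤ v t ∧ v t ≤ 1) → (∀ t ∈ Icc 0 T, 0 ≤ y t ∧ y t ≤ 1) →
      (∀ i, i ≤ k → ∀ t ∈ Icc 0 T, 0 ≤ S i t) → (∀ i, i ≤ k → S i 0 ≤ δ₀) →
      ∀ i, i ≤ k → ∀ t ∈ Icc 0 T, S i t < 1)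
    (hY0 : ∀ t, Y 0 t = 0)
    (hcont : ∀ n, ContinuousOn (Y n) (Icc 0 s))
    (hderiv : ∀ n, 1 ≤ n → ∀ t ∈ Ico 0 s, HasDerivWithinAt (Y n)
      (-κ n * Y n t + F n * (Y (n - 1) t ^ 2 - p * Y n t * Y (n + 1) t)) (Ici t) t)
    (hpos : ∀ n, ∀ t ∈ Icc 0 s, 0 ≤ Y n t)
    (hinit : ∀ n, Y n 0 ≤ δ₀)
    (htail : ∀ n, K ≤ n → ∀ t ∈ Icc 0 s, Y n t ≤ δ₀) :
    ∀ n, ∀ t ∈ Icc 0 s, Y n t ≤ 1 := by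
  -- the bootstrap predicate: the first `K` shells are `< 1`
  set P : ℝ → Prop := fun t => ∀ n, n ≤ K → Y n t < 1 with hP
  have hall : ∀ t ∈ Icc (0 : ℝ) s, P t → ∀ n, Y n t < 1 := by
    intro t ht hPt n
    rcases le_or_gt n K with hn | hn
    · exact hPt n hn
    · exact (htail n hn.le t ht).trans_lt hδ₀
  have hP0 : P 0 := fun n _ => (hinit n).trans_lt hδ₀
  -- THE HEART: `P` is closed from the left — the game at the would-be crossing shell
  have key : ∀ T ∈ Ioc (0 : ℝ) s, (∀ t ∈ Ico 0 T, P t) → P T := by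
    intro T hT hPT n hnK
    have hTs : Icc (0 : ℝ) T ⊆ Icc 0 s := Icc_subset_Icc_right hT.2
    have hTs' : Ico (0 : ℝ) T ⊆ Ico 0 s := Ico_subset_Ico_right hT.2
    -- every shell is `< 1` on `[0, T)` and `≤ 1` on `[0, T]`
    have hlt : ∀ j, ∀ t ∈ Ico (0 : ℝ) T, Y j t < 1 := fun j t ht => hall t (hTs (Ico_subset_Icc_self ht)) (hPT t ht) j
    have hle : ∀ j, ∀ t ∈ Icc (0 : ℝ) T, Y j t ≤ 1 := fun j => le_one_of_lt_one_Ico (hcont j) hT (hlt j)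
    rcases Nat.eq_zero_or_pos n with rfl | hn1
    · rw [hY0]; exact one_pos
    -- the window `m, …, m + k` with `m = max 1 (n - k)` contains `n = m + j`
    set m : ℕ := max 1 (n - k) with hm
    have hm1 : 1 ≤ m := le_max_left _ _
    obtain ⟨j, hjk, hnj⟩ : ∃ j, j ≤ k ∧ n = m + j := by
      refine ⟨n - m, ?_, ?_⟩ <;> simp only [hm] <;> omega
    -- the play
    have hFm : 0 < F m := hF m
    have hrate : ∀ i, F (m + i) = F m * L ^ i := rate_shift hFL m
    have hdamp : ∀ i, κ (m + i) = κ m * b2 ^ i := rate_shift hκg m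
    have hplay := hGame (F m) T hFm hT.1 (fun i => Y (m + i)) (κ m) (Y (m - 1)) (Y (m + k + 1))
      (fun i _ => (hcont (m + i)).mono hTs) ((hcont (m + k + 1)).mono hTs)
      ?_ ?_ (hκ m)
      (fun t ht => ⟨hpos (m - 1) t (hTs ht), hle (m - 1) t ht⟩)
      (fun t ht => ⟨hpos (m + k + 1) t (hTs ht), hle (m + k + 1) t ht⟩)
      (fun i _ t ht => hpos (m + i) t (hTs ht)) (fun i _ => hinit (m + i))
      j hjk T ⟨hT.1.le, le_rfl⟩
    · rw [hnj]; exact hplay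
    · -- the real shells obey the game dynamics (rates `F m · Lⁱ`, feeds and drains re-indexed)
      intro i hi t ht
      have h := hderiv (m + i) (by omega) t (hTs' ht)
      rw [hrate i, hdamp i] at h
      refine h.congr_deriv ?_
      have e1 : (if i = 0 then Y (m - 1) t else Y (m + (i - 1)) t) = Y (m + i - 1) t := by
        split_ifs with hi0
        · rw [hi0, Nat.add_zero]
        · congr 1; omega
      have e2 : (if i = k then Y (m + k + 1) t else Y (m + (i + 1)) t) = Y (m + i + 1) t := by
        split_ifs with hik
        · rw [hik]
        · rfl
      rw [e1, e2]
    · -- the shell above the window is a VIRTUAL FLOOR while the shell above it is `≤ 1`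
      intro t ht
      refine ⟨-κ (m + k + 1) * Y (m + k + 1) t + F (m + k + 1) *
          (Y (m + k + 1 - 1) t ^ 2 - p * Y (m + k + 1) t * Y (m + k + 1 + 1) t),
        hderiv (m + k + 1) (by omega) t (hTs' ht), ?_⟩
      have hr : F (m + k + 1) = F m * L ^ (k + 1) := by rw [← hrate (k + 1)]; rfl
      have hdr : κ (m + k + 1) = κ m * b2 ^ (k + 1) := by rw [← hdamp (k + 1)]; rfl
      have e1 : m + k + 1 - 1 = m + k := by omega
      rw [hr, hdr, e1]
      have hy0 : 0 ≤ Y (m + k + 1) t := hpos _ t (hTs (Ico_subset_Icc_self ht))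
      have hz1 : Y (m + k + 1 + 1) t ≤ 1 := hle _ t (Ico_subset_Icc_self ht)
      have hFL0 : 0 ≤ F m * L ^ (k + 1) := by rw [← hr]; exact (hF _).le
      have h1 : p * Y (m + k + 1) t * Y (m + k + 1 + 1) t ≤ p * Y (m + k + 1) t :=
        mul_le_of_le_one_right (mul_nonneg hp.le hy0) hz1
      nlinarith [mul_le_mul_of_nonneg_left h1 hFL0]
  -- the maximal time of `P` is `s`, and `P` holds on `[0, s]`
  have hPall : ∀ t ∈ Icc (0 : ℝ) s, P t := by
    set T := Literature.Analysis.ODE.maximalTimeP P 0 s with hT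
    have hTmem : T ∈ Icc (0 : ℝ) s := Literature.Analysis.ODE.maximalTimeP_mem hs.le hP0
    have hPT : ∀ t ∈ Icc (0 : ℝ) T, P t := fun t ht =>
      Literature.Analysis.ODE.maximalTimeP_spec hs.le hP0 key ht
    -- `P` is an open condition on finitely many continuous shells: it holds right after `T`
    have hev : ∀ᶠ t in 𝓝[Icc 0 s] T, P t := by
      have hfin : ∀ n ∈ Finset.range (K + 1), ∀ᶠ t in 𝓝[Icc 0 s] T, Y n t < 1 := by
        intro n _
        have hc : ContinuousWithinAt (Y n) (Icc 0 s) T := hcont n T hTmem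
        exact hc.eventually_lt continuousWithinAt_const (hPT T ⟨hTmem.1, le_rfl⟩ n (by
          have := Finset.mem_range.1 ‹n ∈ Finset.range (K + 1)›; omega))
      have := (Finset.eventually_all (Finset.range (K + 1))).2 hfin
      filter_upwards [this] with t ht n hn
      exact ht n (Finset.mem_range.2 (Nat.lt_succ_of_le hn))
    by_cases hTs : T = s
    · intro t ht; exact hPT t (hTs ▸ ht)
    · exact absurd hev (Literature.Analysis.ODE.not_eventually_of_maximalTimeP_lt hs.le hP0
        (lt_of_le_of_ne hTmem.2 hTs))
  intro n t ht
  exact (hall t ht (hPall t ht) n).le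


end Summit.NavierStokesRegularity.NavierStokesRegularity.Theorems.VirtualFloor

end
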